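import Mathlib.Computability.Language
import Mathlib.Logic.Relation
import Mathlib.Logic.Function.Basic
import Mathlib.Data.Finset.Basic
import Literature.Computability.Complexity.Nondeterministic
import HarnessLib

/-!
# Soft Type Assignment with nondeterministic sum (`STA₊`) and soft representability at a level

Soft linear logic as a typed programming language with a LEVEL resource, in the λ-calculus
form of Gaboardi–Ronchi Della Rocca's *Soft Type Assignment* system `STA`
[GaboardiRonchiDellaRocca2007] and its nondeterministic extension `STA₊` of
Gaboardi–Marion–Ronchi Della Rocca [GaboardiMarionRonchidellarocca2008, §5] (the `(sum)` rule of
Maurel's nondeterministic light logics [Maurel2003]). Everything below is the system AS PRINTED in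
[GaboardiMarionRonchidellarocca2008] (= GMR08), in de Bruijn form:

* `STA.LinTy`, `STA.SoftTy` — linear types `A ::= α | σ ⊸ A | ∀α.A` and soft types
  `σ ::= A | !σ` (GMR08 Def. 3.1 (iii)); a soft type is uniquely `!ᵏ A`, encoded as the pair
  `⟨k, A⟩`, so `σ ⊸ A` is `LinTy.limp k B A` with `σ = !ᵏ B`.
* `STA.Term` — the terms `Λ₊ ::= x | M M | λx.M | M + M` (GMR08 Def. 5.1 (i)); the sum-free
  terms (`STA.Term.SumFree`) are the pure λ-terms `Λ` of `STA` (Def. 3.1 (i)).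
* `STA.Typing d Γ M σ` — the judgement `Γ ⊢ M : σ` of `STA₊` (GMR08 Table 2: `(Ax) (w) (⊸I)
  (⊸E) (m) (sp) (∀I) (∀E)`, plus `(sum)` of Table 5) derived by a derivation `Π` of DEGREE
  `d(Π) = d`, the maximal nesting of `(sp)` rules (GMR08 §3.1 and Def. A.1). Contexts are
  partial maps from variable slots `ℕ` to soft types (`STA.Ctx`); the multiplicative side
  condition `Γ # Δ` of `(⊸E)` is `STA.Ctx.Split`, the multiplexor `(m)` contracts a finite set
  `S` of slots of type `σ` into a fresh slot of type `!σ` (`STA.Ctx.mpx`, `STA.mpxRen`), and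
  `(∀I)`'s side condition `α ∉ FTV(Γ)` is the usual de Bruijn shift of the context.
* `STA.Red` — one step of `→βγ`, the contextual closure of `(λx.M)N →β M[N/x]`,
  `M + N →γ M`, `M + N →γ N` (GMR08 Def. 5.2); `STA.Reduces` its reflexive–transitive closure.
* Data (GMR08 §3.2): booleans `B = ∀α.α ⊸ α ⊸ α` with `0 ≐ λxy.x` (`STA.zero`, "true") and
  `1 ≐ λxy.y` (`STA.one`, "false"); boolean strings `S_m = ∀α.!ᵐ(B ⊸ α ⊸ α) ⊸ α ⊸ α` and the
  term `s̲ = λcz.c b₀ (c b₁ (… (c bₖ z)…))` of a word (`STA.encWord`, a bit `false/true` being the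
  letter `0/1`); programs have type `!ⁿ S_m ⊸ B` (`STA.progTy n m`, GMR08 Def. 3.8/5.13).
* `SoftRepresentsAtLevel t L` / `SoftSumRepresentsAtLevel t L` — `L ⊆ {0,1}*` is defined
  (GMR08 Def. 3.8) by a closed sum-free / decided with existential acceptance (GMR08 Def. 5.13)
  by a closed `Λ₊` program `⊢ M : !ⁿ S_m ⊸ B` (`m ≥ 1`) of LEVEL `≤ t`, where the level is
  `max (d(Π)) n` — the degree of the derivation of the applied closed term `M s̲ : B` (the word
  `s̲` is typed with degree `0` and promoted `n` times), which is the exponent governing the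
  polynomial normalisation bounds GMR08 Thm. 3.5 / Thm. 5.12.
* `STAPlusCapturesNP` — the named fact "`STA₊` is correct and complete for `NPTIME`"
  (GMR08 Thm. 5.12 + Thm. 5.14 with Def. 5.13), against the tree's verifier class
  `Literature.Computability.Complexity.Nondeterministic.NP`.

Design choices. (1) The route PneNP/LightLogic asked for Lafont's proof nets OR `STA` terms
(definer's choice); terms are chosen because binding, substitution and reduction are
elementary in de Bruijn form, and `STA`/`STA₊` are the systems for which the cited P- and
NP-characterisations are printed with these exact data types. (2) The degree is an INDEX of the
typing judgement (exact, `max` at binary rules, `+1` at `(sp)`), so "typable with degree `d`" needs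
no separate notion of derivation. (3) One typing relation serves both systems: an `STA₊`
derivation of a sum-free term never uses `(sum)` (every rule but `(sum)` has a sum-free subject
when its premises do, and `(m)` only renames variables), so `STA ⊢ Γ ⊢ M : σ` iff
`STA₊ ⊢ Γ ⊢ M : σ` for `M ∈ Λ`; likewise `→βγ` restricted to sum-free terms is `→β`
(`STA.Red.sumFree`). (4) Mathlib has no λ-calculus, linear logic or light logics (searched
`namespace Lambda|LambdaCalculus|DeBruijn|LinearLogic`, "lambda calculus", "linear logic",
"light affine", "soft linear": no object-level hits; the tree's
`Literature.Computability.ImplicitComplexity.URel` is the relational MODEL of Laurent–Tortora de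
Falco, not a calculus), so the calculus is self-contained; only `Language`,
`Relation.ReflTransGen`, `Finset`, `Function.update` are used from Mathlib.

What is NOT here: subject reduction, strong normalisation, the polynomial soundness theorems
(GMR08 Thm. 3.5, 5.12) and the completeness theorems (Thm. 3.9, 5.14) as Lean theorems — the
NP characterisation is vendored as the named fact `STAPlusCapturesNP`; the P characterisation
(GMR08 Thm. 3.5 + 3.9, Lafont 2004) is a separate literature item; proof nets, `STA_B`/PSPACE
(GMR08 §4) and the relational semantics of Laurent–Tortora de Falco are not defined here.

## References

* [GaboardiMarionRonchidellarocca2008] M. Gaboardi, J.-Y. Marion, S. Ronchi Della Rocca, *Soft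
  Linear Logic and Polynomial Complexity Classes*, ENTCS 205 (2008) 67–87,
  doi:10.1016/j.entcs.2008.03.066 — Def. 3.1, Table 2, §3.1–3.2, Def. 3.8, Thm. 3.5, 3.9;
  Def. 5.1, Table 5, Def. 5.2, Property 3, Thm. 5.12, Def. 5.13, Thm. 5.14; Def. A.1.
* [GaboardiRonchiDellaRocca2007] M. Gaboardi, S. Ronchi Della Rocca, *A Soft Type Assignment
  System for λ-Calculus*, CSL 2007, LNCS 4646, 253–267, doi:10.1007/978-3-540-74915-8_21.
* [Maurel2003] F. Maurel, *Nondeterministic Light Logics and NP-Time*, TLCA 2003, LNCS 2701,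
  241–255, doi:10.1007/3-540-44904-3_17 (the `sum` rule; nondeterministic light affine logic
  is complete for NP).
* [Lafont2004] Y. Lafont, *Soft linear logic and polynomial time*, TCS 318 (2004) 163–180.
-/

namespace Literature.Computability.ImplicitComplexity

namespace STA

/-! ### Soft types (GMR08 Def. 3.1 (iii)), de Bruijn type variables -/

/-- Linear soft types `A ::= α | σ ⊸ A | ∀α.A` of `STA` in de Bruijn form: `tvar i` is the
`i`-th enclosing type variable, `limp k B A` is `(!ᵏ B) ⊸ A` (the argument soft type
`σ = !ᵏ B` split into its number of `!` and its linear kernel), `all A` is `∀α.A` binding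
index `0` of `A`. [cite: GaboardiMarionRonchidellarocca2008, Def. 3.1 (iii)] -/
inductive LinTy : Type
  | tvar (i : ℕ) : LinTy
  | limp (k : ℕ) (dom cod : LinTy) : LinTy
  | all (body : LinTy) : LinTy
  deriving DecidableEq

/-- Soft types `σ ::= A | !σ`: the pair `⟨k, A⟩` encodes `!ᵏ A` (`k = 0`: the linear type `A`).
[cite: GaboardiMarionRonchidellarocca2008, Def. 3.1 (iii)] -/
structure SoftTy : Type where
  /-- number of `!` modalities in front of the linear kernel -/
  bangs : ℕ
  /-- the linear kernel `A` of `!ᵏ A` -/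
  lin : LinTy
  deriving DecidableEq

/-- `!σ`. [cite: GaboardiMarionRonchidellarocca2008, Def. 3.1 (iii)] -/
def SoftTy.bang (σ : SoftTy) : SoftTy := ⟨σ.bangs + 1, σ.lin⟩

/-- Lift a renaming of de Bruijn indices under one binder. [folklore] -/
def liftRen (ρ : ℕ → ℕ) : ℕ → ℕ
  | 0 => 0
  | i + 1 => ρ i + 1

/-- Rename the free type variables of a linear type. [folklore] -/
def LinTy.rename : (ℕ → ℕ) → LinTy → LinTy
  | ρ, .tvar i => .tvar (ρ i)
  | ρ, .limp k d c => .limp k (d.rename ρ) (c.rename ρ)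
  | ρ, .all b => .all (b.rename (liftRen ρ))

/-- Lift a parallel type substitution under one `∀` binder. [folklore] -/
def LinTy.up (τ : ℕ → LinTy) : ℕ → LinTy
  | 0 => .tvar 0
  | i + 1 => (τ i).rename Nat.succ

/-- Parallel (capture-avoiding) substitution of LINEAR types for type variables — substituting
linear types keeps the grammar of soft types. [cite: GaboardiMarionRonchidellarocca2008, §3 (after Def. 3.1)] -/
def LinTy.substp : (ℕ → LinTy) → LinTy → LinTy
  | τ, .tvar i => τ i
  | τ, .limp k d c => .limp k (d.substp τ) (c.substp τ)
  | τ, .all b => .all (b.substp (LinTy.up τ))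

/-- `B[A/α]` for the variable bound by an outermost `∀`: instantiate index `0` of `B` with the
linear type `A` (lowering the other free indices), as in rule `(∀E)`.
[cite: GaboardiMarionRonchidellarocca2008, Table 2 (∀E)] -/
def LinTy.inst (B A : LinTy) : LinTy :=
  B.substp (fun i => match i with | 0 => A | i + 1 => .tvar i)

/-- Shift the free type variables of a soft type by one (used for `(∀I)`). [folklore] -/
def SoftTy.shift (σ : SoftTy) : SoftTy := ⟨σ.bangs, σ.lin.rename Nat.succ⟩

/-! ### Terms `Λ₊` (GMR08 Def. 3.1 (i), Def. 5.1 (i)), de Bruijn -/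

/-- The terms `Λ₊ ::= x | M N | λx.M | M + N` of `STA₊`, de Bruijn indices for variables; the
sum-free ones are the λ-terms `Λ` of `STA`. [cite: GaboardiMarionRonchidellarocca2008, Def. 5.1 (i)] -/
inductive Term : Type
  | var (i : ℕ) : Term
  | app (M N : Term) : Term
  | lam (M : Term) : Term
  | sum (M N : Term) : Term
  deriving DecidableEq

/-- Rename the free variables of a term (simultaneous, capture-free in de Bruijn form); rule `(m)`'s
`M[x/x₁, …, x/xₙ]` is such a renaming. [folklore] -/
def Term.rename : (ℕ → ℕ) → Term → Term
  | ρ, .var i => .var (ρ i)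
  | ρ, .app M N => .app (M.rename ρ) (N.rename ρ)
  | ρ, .lam M => .lam (M.rename (liftRen ρ))
  | ρ, .sum M N => .sum (M.rename ρ) (N.rename ρ)

/-- Lift a parallel term substitution under one `λ`. [folklore] -/
def Term.up (τ : ℕ → Term) : ℕ → Term
  | 0 => .var 0
  | i + 1 => (τ i).rename Nat.succ

/-- Parallel capture-avoiding substitution. [folklore] -/
def Term.substp : (ℕ → Term) → Term → Term
  | τ, .var i => τ i
  | τ, .app M N => .app (M.substp τ) (N.substp τ)
  | τ, .lam M => .lam (M.substp (Term.up τ))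
  | τ, .sum M N => .sum (M.substp τ) (N.substp τ)

/-- `M[N/x]` for the β-rule `(λx.M) N →β M[N/x]`: substitute `N` for index `0` of the body `M`.
[cite: GaboardiMarionRonchidellarocca2008, Def. 3.1 (ii)] -/
def Term.subst0 (M N : Term) : Term :=
  M.substp (fun i => match i with | 0 => N | i + 1 => .var i)

/-- Sum-free terms: the pure λ-terms `Λ ⊆ Λ₊` of the deterministic system `STA`.
[cite: GaboardiMarionRonchidellarocca2008, Def. 3.1 (i)] -/
def Term.SumFree : Term → Prop
  | .var _ => True
  | .app M N => M.SumFree ∧ N.SumFree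
  | .lam M => M.SumFree
  | .sum _ _ => False

/-! ### Reduction (GMR08 Def. 5.2) -/

/-- One step of `→βγ`: the contextual closure of `(λx.M)N →β M[N/x]`, `M + N →γ M` and
`M + N →γ N`. [cite: GaboardiMarionRonchidellarocca2008, Def. 5.2] -/
inductive Red : Term → Term → Prop
  | beta (M N : Term) : Red (.app (.lam M) N) (M.subst0 N)
  | choiceL (M N : Term) : Red (.sum M N) M
  | choiceR (M N : Term) : Red (.sum M N) N
  | appL {M M' : Term} (N : Term) (h : Red M M') : Red (.app M N) (.app M' N)
  | appR (M : Term) {N N' : Term} (h : Red N N') : Red (.app M N) (.app M N')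
  | lam {M M' : Term} (h : Red M M') : Red (.lam M) (.lam M')
  | sumL {M M' : Term} (N : Term) (h : Red M M') : Red (.sum M N) (.sum M' N)
  | sumR (M : Term) {N N' : Term} (h : Red N N') : Red (.sum M N) (.sum M N')

/-- `M →βγ* N`: some (finite, possibly empty) reduction sequence leads from `M` to `N`.
[cite: GaboardiMarionRonchidellarocca2008, Def. 5.2] -/
def Reduces : Term → Term → Prop := Relation.ReflTransGen Red

/-! ### Contexts and the typing rules of `STA₊` (GMR08 Table 2 and Table 5) -/

/-- Contexts: partial finite-or-not maps from variable slots to soft types (`none` = the slot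
carries no assumption). Under a `λ` the bound variable is slot `0` and outer slots shift by one.
[cite: GaboardiMarionRonchidellarocca2008, Def. 3.1 (iv)] -/
abbrev Ctx : Type := ℕ → Option SoftTy

/-- The empty context. [folklore] -/
def Ctx.empty : Ctx := fun _ => none

/-- Extend a context by a new innermost slot `0` (entering a binder). [folklore] -/
def Ctx.cons (a : Option SoftTy) (Γ : Ctx) : Ctx
  | 0 => a
  | i + 1 => Γ i

/-- `!Γ`: prefix every assumption with `!` (rule `(sp)`). [cite: GaboardiMarionRonchidellarocca2008, Table 2 (sp)] -/
def Ctx.bang (Γ : Ctx) : Ctx := fun i => (Γ i).map SoftTy.bang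

/-- Shift the free type variables of every assumption (de Bruijn form of `α ∉ FTV(Γ)` in `(∀I)`).
[cite: GaboardiMarionRonchidellarocca2008, Table 2 (∀I)] -/
def Ctx.shift (Γ : Ctx) : Ctx := fun i => (Γ i).map SoftTy.shift

/-- `Γ = Γ₁, Γ₂` with `Γ₁ # Γ₂`: every assumption of `Γ` goes to exactly one side.
[cite: GaboardiMarionRonchidellarocca2008, Table 2 (⊸E)] -/
def Ctx.Split (Γ Γ₁ Γ₂ : Ctx) : Prop :=
  ∀ i, (Γ₁ i = Γ i ∧ Γ₂ i = none) ∨ (Γ₁ i = none ∧ Γ₂ i = Γ i)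

/-- The singleton context `x : σ` (axiom rule). [cite: GaboardiMarionRonchidellarocca2008, Table 2 (Ax)] -/
def Ctx.IsSingleton (Γ : Ctx) (i : ℕ) (σ : SoftTy) : Prop :=
  Γ i = some σ ∧ ∀ j, j ≠ i → Γ j = none

/-- The context of the conclusion of the multiplexor `(m)`: the slots `x₁, …, xₙ ∈ S` (all of type
`σ` in the premise) are discharged and the fresh slot `j` receives `x : !σ`.
[cite: GaboardiMarionRonchidellarocca2008, Table 2 (m)] -/
def Ctx.mpx (Γ : Ctx) (S : Finset ℕ) (j : ℕ) (σ : SoftTy) : Ctx :=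
  fun i => if i ∈ S then none else if i = j then some σ.bang else Γ i

/-- The renaming `M[x/x₁, …, x/xₙ]` of rule `(m)`: every slot in `S` becomes `j`.
[cite: GaboardiMarionRonchidellarocca2008, Table 2 (m)] -/
def mpxRen (S : Finset ℕ) (j : ℕ) (i : ℕ) : ℕ := if i ∈ S then j else i

/-- `STA.Typing d Γ M σ`: the judgement `Γ ⊢ M : σ` of `STA₊` is derivable by a derivation of
degree exactly `d` (maximal nesting of `(sp)`). Rules, as printed (GMR08 Table 2 + Table 5):
`(Ax)  x : A ⊢ x : A`;
`(w)   Γ ⊢ M : σ ⟹ Γ, x : A ⊢ M : σ` (`A` linear, `x` fresh);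
`(⊸I)  Γ, x : σ ⊢ M : A ⟹ Γ ⊢ λx.M : σ ⊸ A`;
`(⊸E)  Γ ⊢ M : σ ⊸ A, Δ ⊢ N : σ, Γ # Δ ⟹ Γ, Δ ⊢ M N : A`;
`(m)   Γ, x₁ : σ, …, xₙ : σ ⊢ M : μ ⟹ Γ, x : !σ ⊢ M[x/x₁, …, x/xₙ] : μ` (`n ≥ 0`, `x` fresh);
`(sp)  Γ ⊢ M : σ ⟹ !Γ ⊢ M : !σ` (degree `+ 1`);
`(∀I)  Γ ⊢ M : A, α ∉ FTV(Γ) ⟹ Γ ⊢ M : ∀α.A`;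
`(∀E)  Γ ⊢ M : ∀α.B ⟹ Γ ⊢ M : B[A/α]`;
`(sum) Γ ⊢ M : A, Γ ⊢ N : A ⟹ Γ ⊢ M + N : A` (`A` linear, shared context).
For a sum-free `M` this is typability in `STA` (no rule but `(sum)` has a sum in its subject).
[cite: GaboardiMarionRonchidellarocca2008, Table 2, Table 5, Def. A.1 (degree)] -/
inductive Typing : ℕ → Ctx → Term → SoftTy → Prop
  | ax {Γ : Ctx} {i : ℕ} {A : LinTy} (h : Γ.IsSingleton i ⟨0, A⟩) :
      Typing 0 Γ (.var i) ⟨0, A⟩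
  | weak {d : ℕ} {Γ Γ' : Ctx} {M : Term} {τ : SoftTy} (j : ℕ) (A : LinTy)
      (h : Typing d Γ M τ) (hj : Γ j = none) (hΓ' : Γ' = Function.update Γ j (some ⟨0, A⟩)) :
      Typing d Γ' M τ
  | lam {d : ℕ} {Γ : Ctx} {M : Term} {k : ℕ} {B A : LinTy}
      (h : Typing d (Ctx.cons (some ⟨k, B⟩) Γ) M ⟨0, A⟩) :
      Typing d Γ (.lam M) ⟨0, .limp k B A⟩
  | app {d₁ d₂ : ℕ} {Γ Γ₁ Γ₂ : Ctx} {M N : Term} {k : ℕ} {B A : LinTy}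
      (hs : Γ.Split Γ₁ Γ₂) (h₁ : Typing d₁ Γ₁ M ⟨0, .limp k B A⟩) (h₂ : Typing d₂ Γ₂ N ⟨k, B⟩) :
      Typing (max d₁ d₂) Γ (.app M N) ⟨0, A⟩
  | mpx {d : ℕ} {Γ Γ' : Ctx} {M M' : Term} {μ σ : SoftTy} (S : Finset ℕ) (j : ℕ)
      (h : Typing d Γ M μ) (hS : ∀ i ∈ S, Γ i = some σ) (hj : Γ j = none)
      (hΓ' : Γ' = Γ.mpx S j σ) (hM' : M' = M.rename (mpxRen S j)) :
      Typing d Γ' M' μ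
  | sp {d : ℕ} {Γ Γ' : Ctx} {M : Term} {k : ℕ} {A : LinTy}
      (h : Typing d Γ M ⟨k, A⟩) (hΓ' : Γ' = Γ.bang) :
      Typing (d + 1) Γ' M ⟨k + 1, A⟩
  | allI {d : ℕ} {Γ Δ : Ctx} {M : Term} {A : LinTy}
      (h : Typing d Δ M ⟨0, A⟩) (hΔ : Δ = Γ.shift) :
      Typing d Γ M ⟨0, .all A⟩
  | allE {d : ℕ} {Γ : Ctx} {M : Term} {B : LinTy} (A : LinTy)
      (h : Typing d Γ M ⟨0, .all B⟩) :
      Typing d Γ M ⟨0, B.inst A⟩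
  | sum {d₁ d₂ : ℕ} {Γ : Ctx} {M N : Term} {A : LinTy}
      (h₁ : Typing d₁ Γ M ⟨0, A⟩) (h₂ : Typing d₂ Γ N ⟨0, A⟩) :
      Typing (max d₁ d₂) Γ (.sum M N) ⟨0, A⟩

/-! ### Data types (GMR08 §3.2) and programs -/

/-- Booleans `B ≐ ∀α.α ⊸ α ⊸ α`. [cite: GaboardiMarionRonchidellarocca2008, §3.2] -/
def tyB : LinTy := .all (.limp 0 (.tvar 0) (.limp 0 (.tvar 0) (.tvar 0)))

/-- `0 ≐ λxy.x` — GMR08's boolean `0`, which "denotes true": the ACCEPTING answer.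
[cite: GaboardiMarionRonchidellarocca2008, §3.2] -/
def zero : Term := .lam (.lam (.var 1))

/-- `1 ≐ λxy.y` — GMR08's boolean `1` ("false", rejecting). [cite: GaboardiMarionRonchidellarocca2008, §3.2] -/
def one : Term := .lam (.lam (.var 0))

/-- Strings of booleans `S_m ≐ ∀α.!ᵐ(B ⊸ α ⊸ α) ⊸ α ⊸ α` (`S = S₁`).
[cite: GaboardiMarionRonchidellarocca2008, §3.2] -/
def tyS (m : ℕ) : LinTy :=
  .all (.limp m (.limp 0 tyB (.limp 0 (.tvar 0) (.tvar 0))) (.limp 0 (.tvar 0) (.tvar 0)))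

/-- A bit as a letter of `{0,1}`: `false ↦ 0 ≐ λxy.x`, `true ↦ 1 ≐ λxy.y`.
[cite: GaboardiMarionRonchidellarocca2008, §3.2] -/
def encBit : Bool → Term
  | false => zero
  | true => one

/-- The term `s̲ ≐ λc.λz.c b₀ (c b₁ (⋯ (c bₖ z)⋯))` of a word `s = b₀b₁⋯bₖ ∈ {0,1}*` (typable
`⊢ s̲ : S_m` with degree `0` for `m ≥ 1`). [cite: GaboardiMarionRonchidellarocca2008, §3.2] -/
def encWord (w : List Bool) : Term :=
  .lam (.lam (w.foldr (fun b r => .app (.app (.var 1) (encBit b)) r) (.var 0)))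

/-- The type `!ⁿ S_m ⊸ B` of programs deciding a language. [cite: GaboardiMarionRonchidellarocca2008, Def. 3.8, Def. 5.13] -/
def progTy (n m : ℕ) : SoftTy := ⟨0, .limp n (tyS m) tyB⟩

/-- Existential acceptance by the answer `0`: `w ∈ L ⟺` SOME `βγ`-reduction sequence of `M w̲`
reaches (the normal form) `0` — GMR08 Def. 5.13 ("`D(s) = 0 ⟺` there exists a `βγ`-normal form of
`M s̲` equal to `0`"); for sum-free `M` it reads `D(s) = 0 ⟺ M s̲ →β* 0`, GMR08 Def. 3.8.
[cite: GaboardiMarionRonchidellarocca2008, Def. 3.8, Def. 5.13] -/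
def DecidesByZero (M : Term) (L : Language Bool) : Prop :=
  ∀ w : List Bool, w ∈ L ↔ Reduces (.app M (encWord w)) zero

end STA

/-- **Soft representability at level `t` (deterministic).** `L ⊆ {0,1}*` is defined, in the sense
of GMR08 Def. 3.8, by a closed SUM-FREE program `⊢ M : !ⁿ S_m ⊸ B` of `STA` (`m ≥ 1`, so that
every input word is a datum `⊢ s̲ : S_m` of degree `0`, GMR08 §3.2, and the applied term `M s̲ : B`
is typed) whose level `max d(Π) n` is at most `t`: `d(Π) ≤ t` for the degree of the typing
derivation of `M` and `n ≤ t` promotions of the input word, so that every applied term `M s̲ : B`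
is typed with degree `≤ t` (`STA.typing_app_encWord`; this degree is the exponent of the
polynomial bound of GMR08 Thm. 3.5); acceptance is `s ∈ L ⟺ M s̲ →β* 0`.
[cite: GaboardiMarionRonchidellarocca2008, Def. 3.8 (with Table 2, §3.1 degree)] -/
def SoftRepresentsAtLevel (t : ℕ) (L : Language Bool) : Prop :=
  ∃ (M : STA.Term) (d n m : ℕ), M.SumFree ∧ d ≤ t ∧ n ≤ t ∧ 1 ≤ m ∧
    STA.Typing d STA.Ctx.empty M (STA.progTy n m) ∧ STA.DecidesByZero M L

/-- **Soft representability with sum at level `t` (nondeterministic).** `L ⊆ {0,1}*` is defined,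
in the sense of GMR08 Def. 5.13 (existential acceptance: `s ∈ L ⟺` some `βγ`-normal form of `M s̲`
is `0`), by a closed program `⊢ M : !ⁿ S_m ⊸ B` (`m ≥ 1`) of `STA₊` (terms with the nondeterministic sum
`M + N →γ M`, `M + N →γ N` typed by `(sum)`) of level `max d(Π) n ≤ t` (cf.
`SoftRepresentsAtLevel`; the sum rule does not raise the degree).
[cite: GaboardiMarionRonchidellarocca2008, Def. 5.13 (with Def. 5.1, Table 5, Def. 5.2)] -/
def SoftSumRepresentsAtLevel (t : ℕ) (L : Language Bool) : Prop :=
  ∃ (M : STA.Term) (d n m : ℕ), d ≤ t ∧ n ≤ t ∧ 1 ≤ m ∧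
    STA.Typing d STA.Ctx.empty M (STA.progTy n m) ∧ STA.DecidesByZero M L

/-- **`STA₊` characterises NP** (Gaboardi–Marion–Ronchi Della Rocca 2008). Soundness, GMR08
Thm. 5.12: if `Π ▹ Γ ⊢ M : σ` in `STA₊` then `M` evaluates to every one of its `βγ`-normal forms on a
nondeterministic Turing machine in time `O(|M|^{O(d(Π))})`; hence (Def. 5.13) a language decided
with existential acceptance by a closed program `⊢ M : !ⁿ S_m ⊸ B` is in `NP`. Completeness, GMR08
Thm. 5.14: a decision problem decidable by a nondeterministic Turing machine in polynomial time
`P` is definable (Def. 5.13) by a term `⊢ NDTM_P : !^{deg P + 2} S ⊸ B` of `STA₊` (the transition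
RELATION is the sum `Tr₁ + ⋯ + Trₙ` of transition functions). Stated against the tree's class
`NP = polyExists P` of `Literature.Computability.Complexity.Nondeterministic` (verifier form over
Mathlib's `FinTM2` deciders), which coincides with nondeterministic polynomial time on the
paper's Turing machines by the standard polynomial-overhead simulations; the level `t` is
`max d(Π) n` of the program, finite for `NDTM_P`. The light-affine analogue (nondeterministic
`ILAL` with the same `sum` rule is complete for NP) is Maurel 2003.
[cite: GaboardiMarionRonchidellarocca2008, Thm. 5.12 and Thm. 5.14 (with Def. 5.13)] -/
def STAPlusCapturesNP : Prop :=
  ∀ L : Language Bool,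
    L ∈ Literature.Computability.Complexity.Nondeterministic.NP ↔ ∃ t : ℕ, SoftSumRepresentsAtLevel t L

/-! ### API -/

namespace STA

/-- Renaming preserves sum-freeness. [folklore] -/
theorem Term.SumFree.rename {M : Term} (hM : M.SumFree) (ρ : ℕ → ℕ) : (M.rename ρ).SumFree := by
  induction M generalizing ρ with
  | var i => trivial
  | app M N ihM ihN => exact ⟨ihM hM.1 ρ, ihN hM.2 ρ⟩
  | lam M ih => exact ih hM (liftRen ρ)
  | sum M N _ _ => exact hM.elim

/-- Substituting sum-free terms into a sum-free term gives a sum-free term. [folklore] -/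
theorem Term.SumFree.substp {M : Term} (hM : M.SumFree) {τ : ℕ → Term} (hτ : ∀ i, (τ i).SumFree) :
    (M.substp τ).SumFree := by
  induction M generalizing τ with
  | var i => exact hτ i
  | app M N ihM ihN => exact ⟨ihM hM.1 hτ, ihN hM.2 hτ⟩
  | lam M ih =>
    refine ih hM (fun i => ?_)
    cases i with
    | zero => trivial
    | succ i => exact (hτ i).rename Nat.succ
  | sum M N _ _ => exact hM.elim

/-- The deterministic fragment is closed under reduction: a `→βγ` step from a sum-free term is a
`β`-step to a sum-free term (so `Reduces` on `Λ` is `→β*`, GMR08 Def. 3.1 (ii)).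
[cite: GaboardiMarionRonchidellarocca2008, Def. 3.1 (ii), Def. 5.2] -/
theorem Red.sumFree {M N : Term} (h : Red M N) (hM : M.SumFree) : N.SumFree := by
  induction h with
  | beta M N =>
    unfold Term.subst0
    refine Term.SumFree.substp (M := M) hM.1 (fun i => ?_)
    cases i with
    | zero => exact hM.2
    | succ i => trivial
  | choiceL M N => exact hM.elim
  | choiceR M N => exact hM.elim
  | appL N _ ih => exact ⟨ih hM.1, hM.2⟩
  | appR M _ ih => exact ⟨hM.1, ih hM.2⟩
  | lam _ ih => exact ih hM
  | sumL N _ _ => exact hM.elim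
  | sumR M _ _ => exact hM.elim

/-- `Reduces` preserves sum-freeness. [folklore] -/
theorem Reduces.sumFree {M N : Term} (h : Reduces M N) (hM : M.SumFree) : N.SumFree := by
  induction h with
  | refl => exact hM
  | tail _ hst ih => exact hst.sumFree ih

/-- `⊢ 0 : B` with degree `0`, in any assumption-free context (data have degree `0`, GMR08 §3.2):
`(Ax)`, `(w)`, `(⊸I)`, `(⊸I)`, `(∀I)`. [cite: GaboardiMarionRonchidellarocca2008, §3.2] -/
theorem typing_zero (Γ : Ctx) (hΓ : ∀ i, Γ i = none) : Typing 0 Γ zero ⟨0, tyB⟩ := by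
  refine Typing.allI (Δ := Γ.shift) ?_ rfl
  refine Typing.lam (Typing.lam ?_)
  have hΔ : ∀ i, Γ.shift i = none := fun i => by simp [Ctx.shift, hΓ i]
  -- premise of `(w)`: the slot of `y` is empty, `x` (slot 1) is the only assumption
  have hax : Typing 0 (Ctx.cons none (Ctx.cons (some ⟨0, .tvar 0⟩) Γ.shift)) (.var 1) ⟨0, .tvar 0⟩ := by
    refine Typing.ax ⟨rfl, fun j hj => ?_⟩
    rcases j with _ | _ | j
    · rfl
    · exact (hj rfl).elim
    · exact hΔ j
  refine Typing.weak 0 (.tvar 0) hax rfl ?_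
  funext i
  rcases i with _ | _ | j <;> simp [Ctx.cons]

/-- The constant program `⊢ λs.0 : !ⁿ S_m ⊸ B` with degree `0`.
[cite: GaboardiMarionRonchidellarocca2008, §3.2, Table 2] -/
theorem typing_lam_zero (n m : ℕ) : Typing 0 Ctx.empty (.lam zero) (progTy n m) := by
  have h0 : ∀ i, Ctx.cons none Ctx.empty i = none := fun i => by cases i <;> rfl
  cases n with
  | zero =>
    -- `s : S_m` is a LINEAR assumption: weaken with `(w)`
    refine Typing.lam (Typing.weak 0 (tyS m) (typing_zero (Ctx.cons none Ctx.empty) h0) rfl ?_)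
    funext i
    cases i <;> simp [Ctx.cons, Ctx.empty]
  | succ n =>
    -- `s : !ⁿ⁺¹ S_m` is a MODAL assumption: weaken with `(m)` contracting `n = 0` copies
    refine Typing.lam (Typing.mpx (σ := ⟨n, tyS m⟩) ∅ 0
      (typing_zero (Ctx.cons none Ctx.empty) h0) (by simp) rfl ?_ rfl)
    funext i
    cases i <;> simp [Ctx.cons, Ctx.empty, Ctx.mpx, SoftTy.bang]

/-- `(⊸E)` with the degree of the conclusion given by an equation (smart constructor).
[cite: GaboardiMarionRonchidellarocca2008, Table 2 (⊸E)] -/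
theorem Typing.app' {d d₁ d₂ : ℕ} {Γ Γ₁ Γ₂ : Ctx} {M N : Term} {k : ℕ} {B A : LinTy}
    (hs : Γ.Split Γ₁ Γ₂) (h₁ : Typing d₁ Γ₁ M ⟨0, .limp k B A⟩) (h₂ : Typing d₂ Γ₂ N ⟨k, B⟩)
    (hd : d = max d₁ d₂) : Typing d Γ (.app M N) ⟨0, A⟩ := by
  subst hd
  exact Typing.app hs h₁ h₂

/-- `⊢ 1 : B` with degree `0` in any assumption-free context: `(Ax)`, `(⊸I)`, `(w)`, `(⊸I)`, `(∀I)`.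
[cite: GaboardiMarionRonchidellarocca2008, §3.2] -/
theorem typing_one (Γ : Ctx) (hΓ : ∀ i, Γ i = none) : Typing 0 Γ one ⟨0, tyB⟩ := by
  refine Typing.allI (Δ := Γ.shift) ?_ rfl
  have hΔ : ∀ i, Γ.shift i = none := fun i => by simp [Ctx.shift, hΓ i]
  -- `x : α ⊢ λy.y : α ⊸ α` is `(⊸I)` over the axiom `y : α`, then weakened by `x` (slot 1)
  have hax : Typing 0 (Ctx.cons (some ⟨0, .tvar 0⟩) (Ctx.cons none Γ.shift)) (.var 0) ⟨0, .tvar 0⟩ := by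
    refine Typing.ax ⟨rfl, fun j hj => ?_⟩
    rcases j with _ | _ | j
    · exact (hj rfl).elim
    · rfl
    · exact hΔ j
  refine Typing.lam (Typing.weak (Γ := Ctx.cons none Γ.shift) 0 (.tvar 0) (Typing.lam hax) rfl ?_)
  funext i
  rcases i with _ | j <;> simp [Ctx.cons]

/-- Every letter `⊢ b : B` with degree `0`. [cite: GaboardiMarionRonchidellarocca2008, §3.2] -/
theorem typing_encBit (b : Bool) (Γ : Ctx) (hΓ : ∀ i, Γ i = none) : Typing 0 Γ (encBit b) ⟨0, tyB⟩ := by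
  cases b
  · exact typing_zero Γ hΓ
  · exact typing_one Γ hΓ

/-- The linear type `B ⊸ α ⊸ α` of one copy `cᵢ` of the iterator variable of a word. [folklore] -/
def tyF : LinTy := .limp 0 tyB (.limp 0 (.tvar 0) (.tvar 0))

/-- The body `c_s b₀ (c_{s+1} b₁ (⋯ (c_{s+k-1} b_{k-1} z)⋯))` of a word BEFORE multiplexing: the
`k` occurrences of the iterator are distinct linear variables (slots `s, s+1, …`), `z` is slot `0`.
[cite: GaboardiMarionRonchidellarocca2008, §3.2, Table 2 (m)] -/
def wordChain : ℕ → List Bool → Term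
  | _, [] => .var 0
  | s, b :: bs => .app (.app (.var s) (encBit b)) (wordChain (s + 1) bs)

/-- The context `z : α, c_s : B ⊸ α ⊸ α, …, c_{e-1} : B ⊸ α ⊸ α` of `wordChain s bs` (`e = s + |bs|`).
[folklore] -/
def wordCtx (s e : ℕ) : Ctx := fun i =>
  if i = 0 then some ⟨0, .tvar 0⟩ else if s ≤ i ∧ i < e then some ⟨0, tyF⟩ else none

/-- Letters are closed terms: renaming does not change them. [folklore] -/
theorem encBit_rename (b : Bool) (ρ : ℕ → ℕ) : (encBit b).rename ρ = encBit b := by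
  cases b <;> rfl

/-- Slot `0` of `wordCtx` is `z : α`. [folklore] -/
theorem wordCtx_zero (s e : ℕ) : wordCtx s e 0 = some ⟨0, .tvar 0⟩ := rfl

/-- The iterator slots of `wordCtx`. [folklore] -/
theorem wordCtx_of_mem {s e i : ℕ} (h0 : i ≠ 0) (h : s ≤ i ∧ i < e) :
    wordCtx s e i = some ⟨0, tyF⟩ := by
  simp [wordCtx, h0, h]

/-- The empty slots of `wordCtx`. [folklore] -/
theorem wordCtx_of_not_mem {s e i : ℕ} (h0 : i ≠ 0) (h : ¬(s ≤ i ∧ i < e)) :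
    wordCtx s e i = none := by
  simp [wordCtx, h0, h]

/-- `z : α, c_s, …, c_{s+k-1} : B ⊸ α ⊸ α ⊢ wordChain s bs : α` with degree `0` (`k = |bs|`,
`s ≥ 1`), by `(Ax)` and `(⊸E)`. [cite: GaboardiMarionRonchidellarocca2008, §3.2] -/
theorem typing_wordChain (bs : List Bool) (s : ℕ) (hs : 1 ≤ s) :
    Typing 0 (wordCtx s (s + bs.length)) (wordChain s bs) ⟨0, .tvar 0⟩ := by
  induction bs generalizing s with
  | nil =>
    exact Typing.ax ⟨wordCtx_zero _ _, fun j hj =>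
      wordCtx_of_not_mem hj (by simp only [List.length_nil]; omega)⟩
  | cons b bs ih =>
    have he : s + (b :: bs).length = (s + 1) + bs.length := by simp; omega
    rw [he]
    -- the single assumption `c_s : B ⊸ α ⊸ α`, applied to the closed letter `b`
    have h₁ : Typing 0 (fun i => if i = s then some ⟨0, tyF⟩ else none) (.app (.var s) (encBit b))
        ⟨0, .limp 0 (.tvar 0) (.tvar 0)⟩ :=
      Typing.app' (Γ₂ := Ctx.empty) (fun i => Or.inl ⟨rfl, rfl⟩)
        (Typing.ax ⟨by simp [tyF], fun j hj => by simp [hj]⟩) (typing_encBit b _ fun _ => rfl) rfl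
    refine Typing.app' (fun i => ?_) h₁ (ih (s + 1) (by omega)) rfl
    by_cases hi : i = s
    · subst hi
      refine Or.inl ⟨?_, wordCtx_of_not_mem (by omega) (by omega)⟩
      rw [wordCtx_of_mem (by omega) (by omega)]
      simp
    · refine Or.inr ⟨by simp [hi], ?_⟩
      by_cases h0 : i = 0
      · subst h0
        rfl
      · by_cases hr : s + 1 ≤ i ∧ i < s + 1 + bs.length
        · rw [wordCtx_of_mem h0 hr, wordCtx_of_mem h0 (by omega)]
        · rw [wordCtx_of_not_mem h0 hr, wordCtx_of_not_mem h0 (by omega)]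

/-- Multiplexing the iterator copies: `(wordChain s bs)[c/c_s, …]` is the body of `encWord`.
[cite: GaboardiMarionRonchidellarocca2008, Table 2 (m)] -/
theorem wordChain_rename (S : Finset ℕ) (h0 : 0 ∉ S) (bs : List Bool) (s : ℕ)
    (hS : ∀ i, s ≤ i → i < s + bs.length → i ∈ S) :
    (wordChain s bs).rename (mpxRen S 1) =
      bs.foldr (fun b r => .app (.app (.var 1) (encBit b)) r) (.var 0) := by
  induction bs generalizing s with
  | nil => simp [wordChain, Term.rename, mpxRen, h0]
  | cons b bs ih =>
    have hs : s ∈ S := hS s le_rfl (by simp)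
    simp only [wordChain, Term.rename, mpxRen, hs, if_true, encBit_rename, List.foldr_cons]
    rw [ih (s + 1) (fun i hi hi' => hS i (by omega) (by simp; omega))]

/-- **Words are data of degree `0`:** `⊢ s̲ : S` for every `s ∈ {0,1}*`, by `(Ax)`, `(⊸E)`, one
multiplexor `(m)` of rank `|s|` contracting the copies of the iterator, `(⊸I)` twice and `(∀I)`.
[cite: GaboardiMarionRonchidellarocca2008, §3.2] -/
theorem typing_encWord (w : List Bool) : Typing 0 Ctx.empty (encWord w) ⟨0, tyS 1⟩ := by
  refine Typing.allI (Δ := Ctx.empty) ?_ rfl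
  refine Typing.lam (Typing.lam ?_)
  refine Typing.mpx (Γ := wordCtx 2 (2 + w.length)) (σ := ⟨0, tyF⟩) (Finset.Ico 2 (2 + w.length)) 1
    (typing_wordChain w 2 (by omega))
    (fun i hi => wordCtx_of_mem (by have := Finset.mem_Ico.mp hi; omega) (Finset.mem_Ico.mp hi))
    (wordCtx_of_not_mem (by omega) (by omega)) ?_
    (wordChain_rename _ (by simp) w 2 (fun i hi hi' => by simp; omega)).symm
  funext i
  rcases i with _ | _ | i
  · simp [Ctx.cons, Ctx.mpx, wordCtx_zero]
  · simp [Ctx.cons, Ctx.mpx, SoftTy.bang, tyF]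
  · by_cases h : i + 2 < 2 + w.length
    · simp [Ctx.cons, Ctx.empty, Ctx.mpx, h]
    · simp [Ctx.cons, Ctx.empty, Ctx.mpx, h, wordCtx_of_not_mem (show i + 2 ≠ 0 by omega)
        (show ¬(2 ≤ i + 2 ∧ i + 2 < 2 + w.length) by omega)]

/-- **The level of an applied program.** If `⊢ M : !ⁿ S ⊸ B` with degree `d`, then for every word
`⊢ M s̲ : B` with degree `max d n`: promote the degree-`0` word `n` times with `(sp)`, then `(⊸E)`.
[cite: GaboardiMarionRonchidellarocca2008, Table 2 (sp), (⊸E); §3.1] -/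
theorem typing_app_encWord {d n : ℕ} {M : Term} (h : Typing d Ctx.empty M (progTy n 1))
    (w : List Bool) : Typing (max d n) Ctx.empty (.app M (encWord w)) ⟨0, tyB⟩ := by
  have hw : ∀ k, Typing k Ctx.empty (encWord w) ⟨k, tyS 1⟩ := by
    intro k
    induction k with
    | zero => exact typing_encWord w
    | succ k ih => exact Typing.sp ih rfl
  exact Typing.app (fun _ => Or.inl ⟨rfl, rfl⟩) h (hw n)

/-- `(λs.0) N →βγ* 0` for every argument `N`. [cite: GaboardiMarionRonchidellarocca2008, Def. 5.2] -/
theorem reduces_lam_zero_app (N : Term) : Reduces (.app (.lam zero) N) zero :=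
  Relation.ReflTransGen.single (Red.beta zero N)

end STA

/-- A deterministic soft program is a nondeterministic one that happens not to use `sum`:
`STA ⊆ STA₊` at every level. [cite: GaboardiMarionRonchidellarocca2008, Def. 5.1] -/
theorem SoftRepresentsAtLevel.softSum {t : ℕ} {L : Language Bool} (h : SoftRepresentsAtLevel t L) :
    SoftSumRepresentsAtLevel t L := by
  obtain ⟨M, d, n, m, -, hd, hn, hm, hT, hL⟩ := h
  exact ⟨M, d, n, m, hd, hn, hm, hT, hL⟩

/-- Levels are cumulative. [folklore] -/
theorem SoftRepresentsAtLevel.mono {t t' : ℕ} {L : Language Bool} (h : SoftRepresentsAtLevel t L)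
    (ht : t ≤ t') : SoftRepresentsAtLevel t' L := by
  obtain ⟨M, d, n, m, hM, hd, hn, hm, hT, hL⟩ := h
  exact ⟨M, d, n, m, hM, hd.trans ht, hn.trans ht, hm, hT, hL⟩

/-- Levels are cumulative. [folklore] -/
theorem SoftSumRepresentsAtLevel.mono {t t' : ℕ} {L : Language Bool}
    (h : SoftSumRepresentsAtLevel t L) (ht : t ≤ t') : SoftSumRepresentsAtLevel t' L := by
  obtain ⟨M, d, n, m, hd, hn, hm, hT, hL⟩ := h
  exact ⟨M, d, n, m, hd.trans ht, hn.trans ht, hm, hT, hL⟩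

/-- Non-vacuity: the full language is soft-representable at level `0`, by `λs.0`.
[cite: GaboardiMarionRonchidellarocca2008, Def. 3.8] -/
theorem softRepresentsAtLevel_zero_of_forall_mem (L : Language Bool) (hL : ∀ w : List Bool, w ∈ L) :
    SoftRepresentsAtLevel 0 L :=
  ⟨.lam STA.zero, 0, 0, 1, trivial, le_rfl, le_rfl, le_rfl, STA.typing_lam_zero 0 1,
    fun w => ⟨fun _ => STA.reduces_lam_zero_app _, fun _ => hL w⟩⟩

end Literature.Computability.ImplicitComplexity
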